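import Summits.Ventures.GridStability.Lyapunov.StructurePreservingSwitchRoa
import HarnessLib

/-!
# GridStability/Lyapunov/StructurePreservingStepKit — the INJECTION-STEP certificate of the
# structure-preserving model (explicit post-disturbance injections `P¹`, `Σ P¹ = 0`): ONE decidable rational
# check ⇒ the post-step synchronous state EXISTS (enclosed); file 2 `StructurePreservingStepRoa` ⇒
# re-synchronisation from the pre-step synchronous state

Cell `gridfusion` (LADDER-GRIDFUSION), seat gridfusion-lyap-1 (g9), line «G2.b-NE39SP-LOADSTEP» (sibling of
«G2.b-NE39SP-N1-SWITCH»). The switching certificate of `StructurePreservingSwitchKit.lean` ties the kept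
injections to the PRE-switch couplings (`P⁰ = f⁰(halfAngle t0)`); this file frees them: the post-disturbance
model has couplings `w1` on the edge list and ANY rational balanced injection vector `P¹` (`Σᵢ P¹ᵢ = 0`),
while the motion starts from a half-angle point `δ₀ = halfAngle t0` with zero machine speeds (the pre-step
synchronous state). Covered disturbances: sudden load pickup / shedding at a bus supplied by a named machine
(power-transfer step), re-dispatch between machines, and switching + re-dispatch together. MODEL MV-3
(`plan/MODEL-VALIDITY.md`; model-2's `StructurePreserving.Params`).

WHAT IS HERE: `Cert.checkP` — the decidable conjunction (as `Cert.check` with the residual taken against `P¹`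
and the extra conjunct `Σ P¹ = 0`), and **`exists_equilibrium_of_checkP`** — the post-step model has a
synchronous angle vector `θ¹` with `θ¹_r = θ̃_r`, `|θ¹ᵢ − θ̃ᵢ| < R`, all `n` equations `f¹ᵢ(θ¹) = P¹ᵢ` exactly,
every coupled branch inside `γ = 2·arctan τγ < π/2` (lit-1's `ClassicalModel.exists_equilibrium_of_residual_reference`
[cite: DvijothamLowChertkov2015, §3.3 Corollary 1] with coercivity from the supersolution, this seat's
`coercive_of_lapQ` [cite: BermanPlemmons1994, Ch. 6 Thm 2.3]). THREE COLUMNS: a certificate format and its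
soundness for MODEL MV-3; no sentence here says any grid is stable. One `abbrev`; no named fact; standard axioms.
-/

noncomputable section

open Set Filter Topology Real Finset
open Summit.Ventures.GridStability.Models.StructurePreserving
open Summit.Ventures.GridStability.Models.StructurePreserving.Params
open Literature.MathematicalPhysics.PowerSystems

namespace Summit.Ventures.GridStability.Lyapunov.StructurePreserving.Switch

variable {n m : ℕ}

/-- **The ONE decidable check of an injection-step certificate** against edge-list data (`src`, `tgt`,
post-step weights `w1`, post-step injections `P1`, pre-step synchronous tangents `t0`, reference node `r`):
the conjuncts of `Cert.check` with the residual `4Σ_{i ≠ r}(P¹ᵢ − f¹ᵢ(θ̃))² < μ²R²` and the balance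
`Σᵢ P¹ᵢ = 0`. An `abbrev`, so `decide` sees the conjunction. [folklore] -/
abbrev Cert.checkP (C : Cert n m) (src tgt : Fin m → Fin n) (w1 : Fin m → ℚ) (P1 : Fin n → ℚ)
    (t0 : Fin n → ℚ) (r : Fin n) : Prop :=
  (0 < C.R ∧ 0 < C.μ ∧ 0 ≤ C.τ1 ∧ C.τ1 ≤ C.τγ ∧ C.τγ < 1 ∧
    C.R * (1 + quot C.τγ C.τ1 ^ 2) ≤ quot C.τγ C.τ1) ∧
  (∀ e, 0 ≤ w1 e ∧ src e ≠ tgt e ∧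
    (w1 e = 0 ∨
      (-1 < C.t1 (src e) * C.t1 (tgt e) ∧ |quot (C.t1 (src e)) (C.t1 (tgt e))| ≤ C.τ1 ∧
        -1 < t0 (src e) * t0 (tgt e) ∧ |quot (t0 (src e)) (t0 (tgt e))| ≤ 1 ∧
        -1 < quot (t0 (src e)) (t0 (tgt e)) * quot (C.t1 (src e)) (C.t1 (tgt e)) ∧
        C.c < w1 e * (2 * hcos C.τγ - 3141593 / 1000000 * hsin C.τγ)))) ∧
  (∀ i, 0 < C.x i ∧ (i ≠ r → C.μ * C.x i ≤ hcos C.τγ * lapQ src tgt w1 C.x i)) ∧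
  (∑ i, P1 i = 0 ∧
    4 * (∑ i ∈ univ.erase r, (P1 i - flowQ src tgt w1 C.t1 i) ^ 2) < C.μ ^ 2 * C.R ^ 2) ∧
  (∑ e, w1 e * (2 * (|quot (quot (t0 (src e)) (t0 (tgt e)))
      (quot (C.t1 (src e)) (C.t1 (tgt e)))| + C.R) ^ 2)) ≤ C.c

/-- **Existence and enclosure of the post-step synchronous angle vector.** Edge-list data with post-step
weights `w1`, balanced post-step injections `P1`, pre-step tangents `t0`, reference node `r`, and a certificate
`C` passing `C.checkP`: the couplings `b¹ = symmetrize (edgeWeight src tgt w1)` admit `θ¹` with `θ¹_r = θ̃_r`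
(`θ̃ = halfAngle t1`), `|θ¹ᵢ − θ̃ᵢ| < R` at every node, solving ALL `n` power-flow equations
`Σⱼ b¹ᵢⱼ sin(θ¹ᵢ − θ¹ⱼ) = P¹ᵢ` exactly, every coupled pair inside `|θ¹ᵢ − θ¹ⱼ| < 2·arctan τγ`.
[cite: DvijothamLowChertkov2015, §3.3 Corollary 1; BoydVandenberghe2004, §9.1.2 eq. (9.11)] -/
theorem exists_equilibrium_of_checkP {src tgt : Fin m → Fin n} {w1 : Fin m → ℚ} {P1 : Fin n → ℚ}
    {t0 : Fin n → ℚ} {r : Fin n} {C : Cert n m} (hchk : C.checkP src tgt w1 P1 t0 r) :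
    ∃ θ : Fin n → ℝ,
      θ r = halfAngle (fun i => (C.t1 i : ℝ)) r ∧
      (∀ i, |θ i - halfAngle (fun i => (C.t1 i : ℝ)) i| < (C.R : ℝ)) ∧
      (∀ i, ∑ j, symmetrize (edgeWeight src tgt fun e => (w1 e : ℝ)) i j * Real.sin (θ i - θ j)
        = (P1 i : ℝ)) ∧
      (∀ i j, i ≠ j → symmetrize (edgeWeight src tgt fun e => (w1 e : ℝ)) i j ≠ 0 →
        |θ i - θ j| < 2 * Real.arctan (C.τγ : ℝ)) := by
  obtain ⟨⟨hR, hμ, hτ1, hτ1γ, hτγ1, hmar⟩, hedge, hnode, ⟨hsum, hres⟩, -⟩ := hchk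
  set W1 : Fin m → ℝ := fun e => (w1 e : ℝ) with hW1
  set T1 : Fin n → ℝ := fun i => (C.t1 i : ℝ) with hT1
  set PR : Fin n → ℝ := fun i => (P1 i : ℝ) with hPR
  set B := symmetrize (edgeWeight src tgt W1) with hB
  have hW1nn : ∀ e, 0 ≤ W1 e := fun e => by simp only [hW1]; exact_mod_cast (hedge e).1
  have hBs : ∀ i j, B i j = B j i := fun i j => symmetrize_symm _ i j
  have hB0 : ∀ i j, i ≠ j → 0 ≤ B i j := fun i j _ => symmetrize_nonneg (edgeWeight_nonneg hW1nn) i j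
  have hP : ∑ i, PR i = 0 := by
    have := congrArg (fun q : ℚ => (q : ℝ)) hsum
    push_cast at this
    exact this
  have hτγ0 : (0 : ℝ) ≤ (C.τγ : ℝ) := by exact_mod_cast hτ1.trans hτ1γ
  have hτγ1' : (C.τγ : ℝ) < 1 := by exact_mod_cast hτγ1
  have hγπ : 2 * Real.arctan (C.τγ : ℝ) ≤ π := by
    linarith [two_mul_arctan_lt_pi_div_two hτγ1', Real.pi_pos]
  have hc₀ : hcos (C.τγ : ℝ) ≤ Real.cos (2 * Real.arctan (C.τγ : ℝ)) := (hcos_eq_cos _).le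
  have hc₀nn : (0 : ℝ) ≤ hcos (C.τγ : ℝ) := by
    unfold hcos
    apply div_nonneg <;> nlinarith
  have hRr : (0 : ℝ) < (C.R : ℝ) := by exact_mod_cast hR
  have hμr : (0 : ℝ) < (C.μ : ℝ) := by exact_mod_cast hμ
  -- (i) margin
  have hgap : (C.R : ℝ) ≤ Real.arctan (C.τγ : ℝ) - Real.arctan (C.τ1 : ℝ) := by
    have hu0 : (0 : ℝ) ≤ quot (C.τγ : ℝ) (C.τ1 : ℝ) := by
      unfold quot
      apply div_nonneg
      · exact_mod_cast (show (0 : ℚ) ≤ C.τγ - C.τ1 by linarith)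
      · have : (0 : ℝ) ≤ (C.τγ : ℝ) * (C.τ1 : ℝ) := mul_nonneg hτγ0 (by exact_mod_cast hτ1)
        linarith
    have hmar' : (C.R : ℝ) * (1 + quot (C.τγ : ℝ) (C.τ1 : ℝ) ^ 2) ≤ quot (C.τγ : ℝ) (C.τ1 : ℝ) := by
      have := (Rat.cast_le (K := ℝ)).2 hmar
      rw [Rat.cast_mul, Rat.cast_add, Rat.cast_pow, quot_cast, Rat.cast_one] at this
      exact this
    have h1 := le_arctan_of_mul_le hu0 hmar'
    have h2 : 2 * Real.arctan (C.τγ : ℝ) - 2 * Real.arctan (C.τ1 : ℝ)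
        = 2 * Real.arctan (quot (C.τγ : ℝ) (C.τ1 : ℝ)) := by
      have hprod : (-1 : ℝ) < (C.τγ : ℝ) * (C.τ1 : ℝ) := by
        have : (0 : ℝ) ≤ (C.τγ : ℝ) * (C.τ1 : ℝ) := mul_nonneg hτγ0 (by exact_mod_cast hτ1)
        linarith
      exact two_mul_arctan_sub hprod
    linarith
  have hcoh : ∀ i j, i ≠ j → 0 < B i j → |halfAngle T1 i - halfAngle T1 j| + 2 * (C.R : ℝ)
      ≤ 2 * Real.arctan (C.τγ : ℝ) := by
    intro i j _ hpos
    obtain ⟨e, hwe, hor⟩ := exists_ne_zero_edge src tgt W1 hpos.ne'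
    have hwe' : w1 e ≠ 0 := fun h => hwe (by simp [hW1, h])
    obtain ⟨hp1, hq1, -, -, -, -⟩ := (hedge e).2.2.resolve_left hwe'
    have hp1' : (-1 : ℝ) < T1 (src e) * T1 (tgt e) := by simp only [hT1]; exact_mod_cast hp1
    have hq1' : |(T1 (src e) - T1 (tgt e)) / (1 + T1 (src e) * T1 (tgt e))| ≤ (C.τ1 : ℝ) := by
      have := (Rat.cast_le (K := ℝ)).2 hq1
      rw [Rat.cast_abs, quot_cast] at this
      exact this
    have hle : |halfAngle T1 i - halfAngle T1 j| ≤ 2 * Real.arctan (C.τ1 : ℝ) := by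
      rcases hor with ⟨hs, ht⟩ | ⟨hs, ht⟩
      · subst hs; subst ht; exact abs_halfAngle_sub_le hp1' hq1'
      · subst hs; subst ht; rw [abs_sub_comm]; exact abs_halfAngle_sub_le hp1' hq1'
    linarith
  -- (ii) coercivity
  have hsup : ∀ i, i ≠ r → (C.μ : ℝ) * (C.x i : ℝ) ≤ hcos (C.τγ : ℝ) * lapQ src tgt W1 (fun j => (C.x j : ℝ)) i := by
    intro i hi
    have := (Rat.cast_le (K := ℝ)).2 ((hnode i).2 hi)
    rw [Rat.cast_mul, Rat.cast_mul, hcos_cast, lapQ_cast] at this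
    exact this
  have hcoer := coercive_of_lapQ src tgt W1 hW1nn r hc₀nn (fun j => (C.x j : ℝ))
    (fun i => by exact_mod_cast (hnode i).1) hsup
  -- (iii) residual
  have hres' : 4 * ∑ i ∈ univ.erase r,
      (PR i - ∑ j, B i j * Real.sin (halfAngle T1 i - halfAngle T1 j)) ^ 2
      < (C.μ : ℝ) ^ 2 * (C.R : ℝ) ^ 2 := by
    simp_rw [hB, pe_halfAngle_eq_flowQ]
    have := (Rat.cast_lt (K := ℝ)).2 hres
    push_cast at this
    simp_rw [flowQ_cast] at this
    exact this
  obtain ⟨θ, hr, hball, -, heq, hcoh'⟩ :=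
    ClassicalModel.exists_equilibrium_of_residual_reference B PR hBs hB0 hP r
      (halfAngle T1) hγπ hc₀ hRr hμr hcoh hcoer hres'
  refine ⟨θ, hr, hball, heq, fun i j hij hne => hcoh' i j hij ?_⟩
  exact lt_of_le_of_ne (hB0 i j hij) (Ne.symm hne)

/-- **The switching check is the injection-step check at `P¹ := f⁰(halfAngle t0)`** (the kept injections
of the pre-switch couplings `w0`): `Cert.check ⇒ Cert.checkP`. [folklore] -/
theorem Cert.checkP_of_check {C : Cert n m} {src tgt : Fin m → Fin n} {w0 w1 : Fin m → ℚ}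
    {t0 : Fin n → ℚ} {r : Fin n} (h : C.check src tgt w0 w1 t0 r) :
    C.checkP src tgt w1 (flowQ src tgt w0 t0) t0 r := by
  obtain ⟨hsc, hedge, hnode, hres, hener⟩ := h
  refine ⟨hsc, fun e => ⟨(hedge e).2.1, (hedge e).2.2.1, (hedge e).2.2.2⟩, hnode, ⟨?_, hres⟩, hener⟩
  -- losslessness of the pre-switch couplings, over `ℚ`
  have hw0 : ∀ e, (0 : ℚ) ≤ w0 e := fun e => (hedge e).1
  have key : ∀ i, ((flowQ src tgt w0 t0 i : ℚ) : ℝ)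
      = ∑ j, symmetrize (edgeWeight src tgt fun e => (w0 e : ℝ)) i j
          * Real.sin (halfAngle (fun i => (t0 i : ℝ)) i - halfAngle (fun i => (t0 i : ℝ)) j) := fun i => by
    rw [flowQ_cast, pe_halfAngle_eq_flowQ]
  have hreal : ((∑ i, flowQ src tgt w0 t0 i : ℚ) : ℝ) = 0 := by
    push_cast
    simp_rw [key]
    exact ClassicalModel.flow_sum_eq_zero _ (fun i j => symmetrize_symm _ i j) _
  exact_mod_cast hreal

end Summit.Ventures.GridStability.Lyapunov.StructurePreserving.Switch

end
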